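import Summits.AtomisticToContinuum.Crystallization.Theorems.FreeSplittingCertificatesStrictSplittingRuleP1CellMoments

/-!
# `StrictSplittingRule` (stmt-AtomisticToContinuum-12560): SECOND MOMENTS of the reference pieces by symmetry + Cauchy–Schwarz — `∫λ_iλ_j ≤ |T|/16` (P1 interpolant object, part 21)

Route `FreeSplittingCertificates`, crux r3 `StrictSplittingRule` (H12⋆ = `stub_coreJointCoercive`), unit b2b-freesplit-B gen 22.
VALUE = the second brick of the DEMAND side of the transfer (item (2''') of HOME FAR-LEMMA-SPEC §17 (c)(B),(e)): the vertex-quadrature excess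
of a P1 function on a cell is `Σ_{i<j}(f_i − f_j)²·∫λ_iλ_j`, so an UPPER bound of the mixed second moments is what charges the bare radial
deficit to gradient energy.  Without computing any simplex integral: the cyclic symmetry `σ` (part 20) and the coordinate swap `τ` generate the
full symmetric group of the corner simplex `K`, so all `∫_K λ_i²` are equal (`α`) and all `∫_K λ_iλ_j`, `i ≠ j`, are equal (`β`); `Σ_j λ_j = 1`
gives `α + 3β = ∫_K λ₀ = 1/24`, and Cauchy–Schwarz (`∫(λ₀ − 1/4)² ≥ 0`) gives `α ≥ 1/96`, hence **`β ≤ 1/96 = |K|/16`** (exact value `1/120`).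
* `setIntegral_corner_transport` (generic: a measure-preserving self-map of `ℝ³` mapping `K` onto itself transports cell integrals);
* `p1Swap`, `measurePreserving_p1Swap`, `p1Bary_p1Swap_*`;
* `setIntegral_p1Bary_mul_succ`, `…_diag_eq`, `…_offdiag_eq`, `setIntegral_p1Bary_sq_add`, `setIntegral_p1Bary_sq_ge`,
  **`setIntegral_p1Bary_mul_corner_le`**: `∫_K λ_iλ_j ≤ 1/96` for `i ≠ j`.
NOT a proof of H12⋆, NOT summit progress.  [folklore]
-/

noncomputable section

open Set Function Metric MeasureTheory Filter Topology
open scoped BigOperators NNReal ENNReal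

namespace Summit.AtomisticToContinuum.Crystallization.Theorems.StrictSplittingRuleBirth

/-! ## Generic transport of corner-simplex integrals -/

/-- **Transport**: if `φ` preserves Lebesgue measure and maps the corner simplex onto itself (`φ p ∈ K ↔ p ∈ K`), and `g ∘ φ = g'` with `g`
integrable on `K`, then `∫_K g' = ∫_K g`. -/
theorem setIntegral_corner_transport {φ : (Fin 3 → ℝ) → (Fin 3 → ℝ)} (hφ : MeasurePreserving φ volume volume)
    (hmem : ∀ p, φ p ∈ p1RefCell true 0 ↔ p ∈ p1RefCell true 0) {g g' : (Fin 3 → ℝ) → ℝ} (hg : ∀ p, g (φ p) = g' p)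
    (hgi : IntegrableOn g (p1RefCell true 0) volume) :
    ∫ p in p1RefCell true 0, g' p = ∫ p in p1RefCell true 0, g p := by
  have hmeas : MeasurableSet (p1RefCell true 0) := (isClosed_p1RefCell true 0).measurableSet
  rw [← integral_indicator hmeas, ← integral_indicator hmeas]
  have hind : (fun p => (p1RefCell true 0).indicator g' p) = fun p => ((p1RefCell true 0).indicator g) (φ p) := by
    funext p
    by_cases hp : p ∈ p1RefCell true 0
    · rw [indicator_of_mem hp, indicator_of_mem ((hmem p).2 hp), hg]
    · rw [indicator_of_notMem hp, indicator_of_notMem (fun h => hp ((hmem p).1 h))]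
  rw [hind]
  have hf : AEStronglyMeasurable ((p1RefCell true 0).indicator g) (Measure.map φ volume) := by
    rw [hφ.map_eq]
    exact (hgi.integrable_indicator hmeas).aestronglyMeasurable
  rw [← integral_map hφ.measurable.aemeasurable hf, hφ.map_eq]

/-! ## The coordinate swap -/

/-- The swap of the first two chart coordinates (linear, determinant `−1`). -/
def p1SwapLin : (Fin 3 → ℝ) →ₗ[ℝ] (Fin 3 → ℝ) where
  toFun p := ![p 1, p 0, p 2]
  map_add' p q := by ext i; fin_cases i <;> simp
  map_smul' c p := by ext i; fin_cases i <;> simp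

/-- First component of `τ`. -/
@[simp] theorem p1SwapLin_apply_zero (p : Fin 3 → ℝ) : p1SwapLin p 0 = p 1 := by simp [p1SwapLin]
/-- Second component of `τ`. -/
@[simp] theorem p1SwapLin_apply_one (p : Fin 3 → ℝ) : p1SwapLin p 1 = p 0 := by simp [p1SwapLin]
/-- Third component of `τ`. -/
@[simp] theorem p1SwapLin_apply_two (p : Fin 3 → ℝ) : p1SwapLin p 2 = p 2 := by simp [p1SwapLin]

/-- `τ` fixes `λ₀`. -/
theorem p1Bary_p1Swap_zero (p : Fin 3 → ℝ) : p1Bary true 0 0 (p1SwapLin p) = p1Bary true 0 0 p := by simp [p1Bary_corner]; ring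
/-- `τ` exchanges `λ₁` and `λ₂`. -/
theorem p1Bary_p1Swap_one (p : Fin 3 → ℝ) : p1Bary true 0 1 (p1SwapLin p) = p1Bary true 0 2 p := by simp [p1Bary_corner]
/-- `τ` exchanges `λ₂` and `λ₁`. -/
theorem p1Bary_p1Swap_two (p : Fin 3 → ℝ) : p1Bary true 0 2 (p1SwapLin p) = p1Bary true 0 1 p := by simp [p1Bary_corner]
/-- `τ` fixes `λ₃`. -/
theorem p1Bary_p1Swap_three (p : Fin 3 → ℝ) : p1Bary true 0 3 (p1SwapLin p) = p1Bary true 0 3 p := by simp [p1Bary_corner]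

/-- `τ` maps the corner simplex onto itself. -/
theorem p1Swap_mem_iff (p : Fin 3 → ℝ) : p1SwapLin p ∈ p1RefCell true 0 ↔ p ∈ p1RefCell true 0 := by
  simp only [p1RefCell, mem_setOf_eq]
  constructor <;> intro h m <;> have h0 := h 0 <;> have h1 := h 1 <;> have h2 := h 2 <;> have h3 := h 3 <;>
    fin_cases m <;>
    simp only [p1Bary_p1Swap_zero, p1Bary_p1Swap_one, p1Bary_p1Swap_two, p1Bary_p1Swap_three, Fin.zero_eta, Fin.mk_one, Fin.reduceFinMk] at * <;>
    assumption

/-- `τ` preserves Lebesgue measure. -/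
theorem measurePreserving_p1Swap : MeasurePreserving p1SwapLin volume volume := by
  have hdet : LinearMap.det p1SwapLin = -1 := by
    rw [← LinearMap.det_toMatrix', Matrix.det_fin_three]
    simp [LinearMap.toMatrix'_apply, p1SwapLin, Matrix.cons_val_zero, Matrix.cons_val_one]
  have hdet0 : LinearMap.det p1SwapLin ≠ 0 := by rw [hdet]; norm_num
  refine ⟨p1SwapLin.continuous_of_finiteDimensional.measurable, ?_⟩
  rw [Measure.map_linearMap_addHaar_eq_smul_addHaar volume hdet0, hdet]
  simp

/-! ## Second moments of the corner simplex -/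

/-- Products of barycentric coordinates are integrable on the corner simplex. -/
theorem integrableOn_p1Bary_mul_corner (m m' : Fin 4) :
    IntegrableOn (fun p => p1Bary true 0 m p * p1Bary true 0 m' p) (p1RefCell true 0) volume := by
  have hK : IsCompact (p1RefCell true 0) := by
    refine (isCompact_Icc (a := (0 : Fin 3 → ℝ)) (b := 1)).of_isClosed_subset (isClosed_p1RefCell true 0) fun p hp => ?_
    exact ⟨fun i => (p1RefCell_subset_cube hp i).1, fun i => (p1RefCell_subset_cube hp i).2⟩
  have hc : Continuous fun p : Fin 3 → ℝ => p1Bary true 0 m p * p1Bary true 0 m' p := by unfold p1Bary; fun_prop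
  exact hc.continuousOn.integrableOn_compact hK

/-- Cyclic symmetry of the second moments: `∫ λ_{m+1}λ_{m'+1} = ∫ λ_m λ_{m'}`. -/
theorem setIntegral_p1Bary_mul_succ (m m' : Fin 4) :
    ∫ p in p1RefCell true 0, p1Bary true 0 (m + 1) p * p1Bary true 0 (m' + 1) p = ∫ p in p1RefCell true 0, p1Bary true 0 m p * p1Bary true 0 m' p :=
  (setIntegral_corner_transport measurePreserving_p1Cyc p1Cyc_mem_iff (g := fun q => p1Bary true 0 (m + 1) q * p1Bary true 0 (m' + 1) q)
    (fun p => by simp only [p1Bary_p1Cyc]) (integrableOn_p1Bary_mul_corner _ _)).symm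

/-- All diagonal second moments are equal: `∫ λ_m² = ∫ λ₀²`. -/
theorem setIntegral_p1Bary_sq_eq (m : Fin 4) :
    ∫ p in p1RefCell true 0, p1Bary true 0 m p * p1Bary true 0 m p = ∫ p in p1RefCell true 0, p1Bary true 0 0 p * p1Bary true 0 0 p := by
  have h1 : ∫ p in p1RefCell true 0, p1Bary true 0 1 p * p1Bary true 0 1 p = ∫ p in p1RefCell true 0, p1Bary true 0 0 p * p1Bary true 0 0 p := by
    simpa using setIntegral_p1Bary_mul_succ 0 0
  have h2 : ∫ p in p1RefCell true 0, p1Bary true 0 2 p * p1Bary true 0 2 p = ∫ p in p1RefCell true 0, p1Bary true 0 1 p * p1Bary true 0 1 p := by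
    simpa using setIntegral_p1Bary_mul_succ 1 1
  have h3 : ∫ p in p1RefCell true 0, p1Bary true 0 3 p * p1Bary true 0 3 p = ∫ p in p1RefCell true 0, p1Bary true 0 2 p * p1Bary true 0 2 p := by
    simpa using setIntegral_p1Bary_mul_succ 2 2
  fin_cases m <;> simp only [Fin.zero_eta, Fin.mk_one, Fin.reduceFinMk] <;> linarith

/-- All mixed second moments are equal: `∫ λ_m λ_{m'} = ∫ λ₀λ₁` for `m ≠ m'` (cyclic symmetry and the swap `τ`). -/
theorem setIntegral_p1Bary_offdiag_eq {m m' : Fin 4} (hne : m ≠ m') :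
    ∫ p in p1RefCell true 0, p1Bary true 0 m p * p1Bary true 0 m' p = ∫ p in p1RefCell true 0, p1Bary true 0 0 p * p1Bary true 0 1 p := by
  -- the cyclic orbit of (0,1): (1,2), (2,3), (3,0); and of (0,2): (1,3); the swap sends (0,2) to (0,1)
  have c01 : ∫ p in p1RefCell true 0, p1Bary true 0 1 p * p1Bary true 0 2 p = ∫ p in p1RefCell true 0, p1Bary true 0 0 p * p1Bary true 0 1 p := by
    simpa using setIntegral_p1Bary_mul_succ 0 1
  have c12 : ∫ p in p1RefCell true 0, p1Bary true 0 2 p * p1Bary true 0 3 p = ∫ p in p1RefCell true 0, p1Bary true 0 1 p * p1Bary true 0 2 p := by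
    simpa using setIntegral_p1Bary_mul_succ 1 2
  have c23 : ∫ p in p1RefCell true 0, p1Bary true 0 3 p * p1Bary true 0 0 p = ∫ p in p1RefCell true 0, p1Bary true 0 2 p * p1Bary true 0 3 p := by
    simpa using setIntegral_p1Bary_mul_succ 2 3
  have c02 : ∫ p in p1RefCell true 0, p1Bary true 0 1 p * p1Bary true 0 3 p = ∫ p in p1RefCell true 0, p1Bary true 0 0 p * p1Bary true 0 2 p := by
    simpa using setIntegral_p1Bary_mul_succ 0 2
  have s02 : ∫ p in p1RefCell true 0, p1Bary true 0 0 p * p1Bary true 0 1 p = ∫ p in p1RefCell true 0, p1Bary true 0 0 p * p1Bary true 0 2 p :=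
    setIntegral_corner_transport measurePreserving_p1Swap p1Swap_mem_iff (g := fun q => p1Bary true 0 0 q * p1Bary true 0 2 q)
      (fun p => by rw [p1Bary_p1Swap_zero, p1Bary_p1Swap_two]) (integrableOn_p1Bary_mul_corner _ _)
  have comm : ∀ i j : Fin 4, ∫ p in p1RefCell true 0, p1Bary true 0 i p * p1Bary true 0 j p = ∫ p in p1RefCell true 0, p1Bary true 0 j p * p1Bary true 0 i p :=
    fun i j => by simp only [mul_comm]
  have c30 := comm 3 0
  have c31 := comm 3 1
  have c32 := comm 3 2
  have c20 := comm 2 0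
  have c21 := comm 2 1
  have c10 := comm 1 0
  fin_cases m <;> fin_cases m' <;> simp only [Fin.zero_eta, Fin.mk_one, Fin.reduceFinMk] at hne ⊢ <;>
    first | exact absurd rfl hne | linarith

/-- **Partition of unity at second order**: `∫λ₀² + 3∫λ₀λ₁ = ∫λ₀ = 1/24`. -/
theorem setIntegral_p1Bary_sq_add :
    (∫ p in p1RefCell true 0, p1Bary true 0 0 p * p1Bary true 0 0 p) + 3 * (∫ p in p1RefCell true 0, p1Bary true 0 0 p * p1Bary true 0 1 p) = 1 / 24 := by
  have i00 := integrableOn_p1Bary_mul_corner 0 0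
  have i01 := integrableOn_p1Bary_mul_corner 0 1
  have i02 := integrableOn_p1Bary_mul_corner 0 2
  have i03 := integrableOn_p1Bary_mul_corner 0 3
  have e02 : ∫ p in p1RefCell true 0, p1Bary true 0 0 p * p1Bary true 0 2 p = ∫ p in p1RefCell true 0, p1Bary true 0 0 p * p1Bary true 0 1 p :=
    setIntegral_p1Bary_offdiag_eq (by decide)
  have e03 : ∫ p in p1RefCell true 0, p1Bary true 0 0 p * p1Bary true 0 3 p = ∫ p in p1RefCell true 0, p1Bary true 0 0 p * p1Bary true 0 1 p :=
    setIntegral_p1Bary_offdiag_eq (by decide)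
  have hsum : (∫ p in p1RefCell true 0, p1Bary true 0 0 p * p1Bary true 0 0 p) + (∫ p in p1RefCell true 0, p1Bary true 0 0 p * p1Bary true 0 1 p) +
      (∫ p in p1RefCell true 0, p1Bary true 0 0 p * p1Bary true 0 2 p) + (∫ p in p1RefCell true 0, p1Bary true 0 0 p * p1Bary true 0 3 p) = 1 / 24 := by
    have i0001 : IntegrableOn (fun p => p1Bary true 0 0 p * p1Bary true 0 0 p + p1Bary true 0 0 p * p1Bary true 0 1 p) (p1RefCell true 0) volume :=
      i00.add i01
    have i012 : IntegrableOn (fun p => p1Bary true 0 0 p * p1Bary true 0 0 p + p1Bary true 0 0 p * p1Bary true 0 1 p +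
        p1Bary true 0 0 p * p1Bary true 0 2 p) (p1RefCell true 0) volume := i0001.add i02
    rw [← integral_add i00 i01, ← integral_add i0001 i02, ← integral_add i012 i03, ← setIntegral_p1Bary_corner 0]
    refine setIntegral_congr_fun (isClosed_p1RefCell true 0).measurableSet fun p _ => ?_
    simp [p1Bary, p1BaryCoef]; ring
  linarith

/-- **Cauchy–Schwarz**: `∫_K λ₀² ≥ (∫_K λ₀)²/|K| = 1/96` (from `∫_K (λ₀ − 1/4)² ≥ 0`). -/
theorem setIntegral_p1Bary_sq_ge : 1 / 96 ≤ ∫ p in p1RefCell true 0, p1Bary true 0 0 p * p1Bary true 0 0 p := by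
  have hmeas : MeasurableSet (p1RefCell true 0) := (isClosed_p1RefCell true 0).measurableSet
  have i00 := integrableOn_p1Bary_mul_corner 0 0
  have i0 := integrableOn_p1Bary_corner true 0 0 true 0
  have hnn : 0 ≤ ∫ p in p1RefCell true 0, (p1Bary true 0 0 p - 1 / 4) ^ 2 := setIntegral_nonneg hmeas fun p _ => sq_nonneg _
  have hexp : ∫ p in p1RefCell true 0, (p1Bary true 0 0 p - 1 / 4) ^ 2 =
      (∫ p in p1RefCell true 0, p1Bary true 0 0 p * p1Bary true 0 0 p) - 1 / 2 * (∫ p in p1RefCell true 0, p1Bary true 0 0 p) +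
        ∫ p in p1RefCell true 0, (1 / 16 : ℝ) := by
    have i1 : IntegrableOn (fun p => p1Bary true 0 0 p * p1Bary true 0 0 p - 1 / 2 * p1Bary true 0 0 p) (p1RefCell true 0) volume :=
      i00.sub (i0.const_mul _)
    have ic : IntegrableOn (fun _ => (1 / 16 : ℝ)) (p1RefCell true 0) volume := by
      refine integrableOn_const ?_
      rw [volume_p1RefCell]; norm_num
    rw [← integral_const_mul, ← integral_sub i00 (i0.const_mul _), ← integral_add i1 ic]
    refine setIntegral_congr_fun hmeas fun p _ => ?_
    ring
  rw [hexp, setIntegral_p1Bary_corner 0, setIntegral_const, measureReal_def, volume_p1RefCell, ENNReal.toReal_inv] at hnn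
  norm_num at hnn
  linarith

/-- **Mixed second moments of the corner simplex are at most `|K|/16 = 1/96`** (exact value `1/120`), for every `i ≠ j`.
NOT a proof of H12⋆, NOT summit progress. -/
theorem setIntegral_p1Bary_mul_corner_le {m m' : Fin 4} (hne : m ≠ m') :
    ∫ p in p1RefCell true 0, p1Bary true 0 m p * p1Bary true 0 m' p ≤ 1 / 96 := by
  rw [setIntegral_p1Bary_offdiag_eq hne]
  linarith [setIntegral_p1Bary_sq_add, setIntegral_p1Bary_sq_ge]

end Summit.AtomisticToContinuum.Crystallization.Theorems.StrictSplittingRuleBirth
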